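import Mathlib.Combinatorics.SetFamily.HarrisKleitman
import Mathlib.Data.Finset.Sups
import HarnessLib

/-!
# `NoHeavyLowerTail` (crux stmt-CriticalPhenomena-4575), Sahi programme P1: the BOOLEAN FACE of the z-profile of the pattern functional
# — a three-family Harris–Kleitman inequality, every dimension

Support file (Sahi cell, seat `prim-sahi-p1`, generation 8; `--supports stmt-CriticalPhenomena-4575`).  Pure proofs, no definitions, no
`sorry`, standard axioms; Mathlib's Harris–Kleitman inequality is the only input.

THE MATHEMATICS.  For the pattern functional `S_d(A,B,C) = Σ_{π ∈ S₃^d} h(P^π_0,P^π_1,P^π_2)` of `…SahiGridPattern` (Sahi's three-copy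
kernel `h(x,y,z) = 2A(x)B(x)C(x) − A(x)B(y)C(y) − B(x)A(y)C(y) − C(x)A(y)B(y) + A(x)B(y)C(z)` summed over three-point Latin hypercube
samples of `[3]^d`), CONDITIONING ON THE THIRD COPY `z = u` leaves `(x,y)` a uniformly random ANTIPODAL pair of the Boolean sub-cube
`Q_u = ∏_a ([3]∖{u_a}) ≅ 2^[d]` (`y = x̄`, the complement of `x` in `Q_u`), on which `A, B, C` restrict to up-sets.  Hence
`S_d(A,B,C) = Σ_u G_u(A,B,C)` with the z-PROFILE
  `G_u = 2|ABC|_u − |A ∩ σ(BC)|_u − |B ∩ σ(AC)|_u − |C ∩ σ(AB)|_u + 1_C(u)·|A ∩ σB|_u`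
(`|·|_u` counts inside `Q_u`, `σ` = complementation of `Q_u`, so `σ` of an up-set is a down-set).  THIS FILE proves the set-family
inequality behind the THEOREM "`G_u(A,B,C) ≥ 0` for every `u ∈ C`, in every dimension":
* `card_inter_compls_inter_le` (Kleitman, then Harris): for upper families `𝒜, ℬ, 𝒞 ⊆ 2^[n]`,
  `#(𝒜 ∩ (ℬ ∩ 𝒞)ᶜˢ) ≤ #(𝒜 ∩ ℬ ∩ 𝒞)` — an upper family meets the complements of an upper family at most as often as it meets the family.
* `zProfile_face_nonneg` (**the Boolean face of the z-profile**): for upper families `𝒜, ℬ, 𝒞`,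
  `#(𝒜 ∩ (ℬ ∩ 𝒞)ᶜˢ) + #(ℬ ∩ (𝒜 ∩ 𝒞)ᶜˢ) + #(𝒞 ∩ (𝒜 ∩ ℬ)ᶜˢ) ≤ 2·#(𝒜 ∩ ℬ ∩ 𝒞) + #(𝒜 ∩ ℬᶜˢ)`,
  i.e. `2|ABC| + #{x∈A : x̄∈B} ≥ #{x∈A : x̄∈B∩C} + #{x∈B : x̄∈A∩C} + #{x∈C : x̄∈A∩B}` on the Boolean lattice (verified exhaustively for
  `n ≤ 4`, 4.7·10⁶ triples, before the proof was found; generation-8 memo §3).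
CONTEXT (generation-8 memo HOME/FROM-prim-sahi-p1-gen8-PATTERNPOS4-SLICES.md §3, PROOF-C3 §22(e)): CONJECTURE G says the whole z-profile
`u ↦ G_u` lies in the dual cone of up-sets (`Σ_{u∈U} G_u ≥ 0` for every up-set `U`; `U = [3]^d` is `PatternPos d`); this file settles
its faces `U ⊆ C` (pointwise nonnegativity on `C`); off `C` the same bounds only give `G_u ≥ −|A ∩ σ_u(B∩C)|_u`.  Nothing conjectural
is asserted here; the transport `Q_u ≅ 2^[d]` to the pattern functional is not formalised in this file. [this work]
-/

namespace Summit.CriticalPhenomena.PercolationContinuityZ3.Theorems.SahiGridPattern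

open Finset
open scoped FinsetFamily

variable {α : Type*} [DecidableEq α] [Fintype α]

/-- The complements of an upper family form a lower family. [this work] -/
theorem isLowerSet_compls {𝒜 : Finset (Finset α)} (h : IsUpperSet (𝒜 : Set (Finset α))) :
    IsLowerSet ((𝒜ᶜˢ : Finset (Finset α)) : Set (Finset α)) := by
  intro s t hts hs
  rw [Finset.mem_coe, Finset.mem_compls] at hs ⊢
  exact h (compl_le_compl hts) hs

omit [Fintype α] in
/-- Intersections of upper families are upper (finset form). [this work] -/
theorem isUpperSet_inter {𝒜 ℬ : Finset (Finset α)} (h𝒜 : IsUpperSet (𝒜 : Set (Finset α)))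
    (hℬ : IsUpperSet (ℬ : Set (Finset α))) : IsUpperSet ((𝒜 ∩ ℬ : Finset (Finset α)) : Set (Finset α)) := by
  rw [Finset.coe_inter]; exact h𝒜.inter hℬ

/-- **Kleitman, then Harris**: an upper family `𝒜` meets the complements of an upper family `𝒟` at most as often as it meets `𝒟`:
`#(𝒜 ∩ 𝒟ᶜˢ) ≤ #(𝒜 ∩ 𝒟)`. [this work] -/
theorem card_inter_compls_le {𝒜 𝒟 : Finset (Finset α)} (h𝒜 : IsUpperSet (𝒜 : Set (Finset α)))
    (h𝒟 : IsUpperSet (𝒟 : Set (Finset α))) : #(𝒜 ∩ 𝒟ᶜˢ) ≤ #(𝒜 ∩ 𝒟) := by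
  have h1 : 2 ^ Fintype.card α * #(𝒜 ∩ 𝒟ᶜˢ) ≤ #𝒜 * #𝒟ᶜˢ := h𝒜.card_inter_le_finset (isLowerSet_compls h𝒟)
  have h2 : #𝒜 * #𝒟 ≤ 2 ^ Fintype.card α * #(𝒜 ∩ 𝒟) := h𝒜.le_card_inter_finset h𝒟
  rw [card_compls] at h1
  exact Nat.le_of_mul_le_mul_left (h1.trans h2) (Nat.two_pow_pos _)

/-- `#(𝒜 ∩ (ℬ ∩ 𝒞)ᶜˢ) ≤ #(𝒜 ∩ ℬ ∩ 𝒞)` for upper families. [this work] -/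
theorem card_inter_compls_inter_le {𝒜 ℬ 𝒞 : Finset (Finset α)} (h𝒜 : IsUpperSet (𝒜 : Set (Finset α)))
    (hℬ : IsUpperSet (ℬ : Set (Finset α))) (h𝒞 : IsUpperSet (𝒞 : Set (Finset α))) :
    #(𝒜 ∩ (ℬ ∩ 𝒞)ᶜˢ) ≤ #(𝒜 ∩ ℬ ∩ 𝒞) := by
  have h := card_inter_compls_le h𝒜 (isUpperSet_inter hℬ h𝒞)
  rwa [← inter_assoc] at h

/-- Monotonicity: `#(𝒜 ∩ (ℬ ∩ 𝒞)ᶜˢ) ≤ #(𝒜 ∩ ℬᶜˢ)`. [this work] -/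
theorem card_inter_compls_inter_le_left (𝒜 ℬ 𝒞 : Finset (Finset α)) : #(𝒜 ∩ (ℬ ∩ 𝒞)ᶜˢ) ≤ #(𝒜 ∩ ℬᶜˢ) := by
  refine card_le_card (inter_subset_inter_left ?_)
  rw [compls_inter]; exact inter_subset_left

/-- **The Boolean face of the z-profile** (every dimension): for upper families `𝒜, ℬ, 𝒞 ⊆ 2^[n]`,
`#(𝒜 ∩ (ℬ∩𝒞)ᶜˢ) + #(ℬ ∩ (𝒜∩𝒞)ᶜˢ) + #(𝒞 ∩ (𝒜∩ℬ)ᶜˢ) ≤ 2·#(𝒜∩ℬ∩𝒞) + #(𝒜 ∩ ℬᶜˢ)`, i.e.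
`2|ABC| + #{x∈A : x̄∈B} − #{x∈A : x̄∈B∩C} − #{x∈B : x̄∈A∩C} − #{x∈C : x̄∈A∩B} ≥ 0` — the value `G_u(A,B,C)` of the z-profile of
Sahi's three-copy pattern functional at a point `u ∈ C` (with `2^[n] ≅` the Boolean sub-cube around `u`). [this work] -/
theorem zProfile_face_nonneg {𝒜 ℬ 𝒞 : Finset (Finset α)} (h𝒜 : IsUpperSet (𝒜 : Set (Finset α)))
    (hℬ : IsUpperSet (ℬ : Set (Finset α))) (h𝒞 : IsUpperSet (𝒞 : Set (Finset α))) :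
    #(𝒜 ∩ (ℬ ∩ 𝒞)ᶜˢ) + #(ℬ ∩ (𝒜 ∩ 𝒞)ᶜˢ) + #(𝒞 ∩ (𝒜 ∩ ℬ)ᶜˢ) ≤ 2 * #(𝒜 ∩ ℬ ∩ 𝒞) + #(𝒜 ∩ ℬᶜˢ) := by
  have h1 : #(𝒜 ∩ (ℬ ∩ 𝒞)ᶜˢ) ≤ #(𝒜 ∩ ℬᶜˢ) := card_inter_compls_inter_le_left 𝒜 ℬ 𝒞
  have h2 : #(ℬ ∩ (𝒜 ∩ 𝒞)ᶜˢ) ≤ #(𝒜 ∩ ℬ ∩ 𝒞) := by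
    have := card_inter_compls_inter_le hℬ h𝒜 h𝒞
    rwa [show ℬ ∩ 𝒜 ∩ 𝒞 = 𝒜 ∩ ℬ ∩ 𝒞 by rw [inter_comm ℬ 𝒜]] at this
  have h3 : #(𝒞 ∩ (𝒜 ∩ ℬ)ᶜˢ) ≤ #(𝒜 ∩ ℬ ∩ 𝒞) := by
    have := card_inter_compls_inter_le h𝒞 h𝒜 hℬ
    rwa [show 𝒞 ∩ 𝒜 ∩ ℬ = 𝒜 ∩ ℬ ∩ 𝒞 by rw [inter_assoc, inter_comm]] at this
  omega

end Summit.CriticalPhenomena.PercolationContinuityZ3.Theorems.SahiGridPattern
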